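import Summits.RiemannHypothesis.RiemannHypothesis.Theorems.TiltedLandingLaw421R3RateSplit
import Summits.RiemannHypothesis.RiemannHypothesis.Theorems.TiltedLandingLaw421R3FarStep6Sharp
import Summits.RiemannHypothesis.RiemannHypothesis.Theorems.TiltedLandingLaw421R3AntiEscapeSplit7

/-! # LENS-2 (rh33346) — «Burgers characteristics of the level flow» applied to the RATE law F1 = `RhW08.SealSwapQ.FarEnergyLawCQ (4/5)`

Planner sketch (ideator seat `rh33346-lens-2-g0`; NOT a route item, NOT a skeleton; typed so the critic/instrument can price it).
Target crux: `Summit.RiemannHypothesis.RiemannHypothesis.Theses.EarlyAppointments.TiltedLandingLaw421R` (⟨33346⟩) via the registered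
RATE residual `RhW08.RateSplit.RateLawsHalfQ`, conjunct F1 `FarEnergyLawCQ (4/5)` first (CA438).

DICTIONARY (explicit, checkable): level `j` ↦ time; the zero set of `f⁽ʲ⁾` ↦ a measure; the FAR FIELD at the tracked pair `v`
(`farFieldAt f j v w` below = `f⁽ʲ⁺¹⁾/f⁽ʲ⁾ (w) − 1/(w−v) − 1/(w−v̄)`, the cofactor field `K = h′/h` of the far-step kit `RhW08.FarStep`) ↦ the
Cauchy–Stieltjes transform off the pair; ONE differentiation ↦ the EXACT discrete Riccati step `φ_{j+1} = φ_j + φ_j′/φ_j` (`RiccatiStep`);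
its continuum limit is complex inviscid Burgers for the velocity `u = −1/K` (`u_t + u·u_z = 0`): roots move on straight characteristics with
constant velocity, i.e. **the field at a tagged root is conserved along the flow**.  Discretely the conservation is exact to first order
(the march `−1/K` times the gradient `K′` cancels the Riccati increment `K′/K`), so along a FAR CHAIN the far field at the tracked pair is an
adiabatic invariant (`TiltInvarianceLaw θ`), and F1 follows from the tree's sharp far step `RhW08.FarStep.sharp_step_energy_eta_weak`
(field bound `‖K(w)‖ ≤ (√5/2)·η/s` ⇒ the `4/5` summand) once the chain's ENTRY value is `≤ η/s` (`FarEntryLaw`).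
Measured (pure-python exact level tracker on the exactly-evolvable frames `(z²+b²)(z−D)^N e^{cz}`, legal at level 0 with tilt `c` up to `1.86·η/s`
screened to `‖K₀‖ = 0.86·η/s`): relative drift of `‖K_j(v_j)‖` = +1.0e-3 over 20 charged far levels (D = 10R), +2.3 % over 36 far levels (D = 2R);
F1(4/5) never violated (slack ≥ 2.25×); the pair lands after ≲ b²‖K‖² levels.  Nothing here bears on the truth of RH; RH is not proved. -/

namespace RhW08.BurgersRate

open Complex
open scoped ComplexConjugate
open RhIdea6.G17.W07C7 RhIdea6.G17.W07C7.Rev6 RhIdea6.G18.W07C8.Law421BirthS RhIdea6.G19.W07C11.Seam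
open RhIdea6.G20.W07C12.Frac RhIdea6.G20.W07C12.StColP RhW07.C12.FieldSplit RhIdea6.G21.W07C13.TentMax
open RhW07.C14.TwoSided RhW07.C14.Classes RhW07.C14.Lineage RhW07.C14.Booking
open RhW08.Round1 RhW08.StSwap RhW08.Round2 RhW08.QuadW
open RhW08.SealSwap (PBot)
open RhW08.SealSwapQ RhW08.RateSplit RhW08.IsolatedTilt RhW08.FarStep

/-- The level-`j` total field `φ_j = f⁽ʲ⁺¹⁾/f⁽ʲ⁾` (meromorphic expression; junk where `f⁽ʲ⁾ w = 0`). -/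
noncomputable def levelField (f : ℂ → ℂ) (j : ℕ) (w : ℂ) : ℂ :=
  iteratedDeriv (j + 1) f w / iteratedDeriv j f w

/-- The FAR FIELD of level `j` at `w`, off the tracked pair `v, v̄`: `φ_j(w) − 1/(w − v) − 1/(w − v̄)` (= the cofactor field `h′/h` of the
far-step kit when `f⁽ʲ⁾ = pairQ (Re v) (Im v) · h`). No new structure: an expression in `iteratedDeriv`. -/
noncomputable def farFieldAt (f : ℂ → ℂ) (j : ℕ) (v w : ℂ) : ℂ :=
  levelField f j w - 1 / (w - v) - 1 / (w - conj v)

/-- The TILT of level `j` at a state `v` (a simple zero of `f⁽ʲ⁾`): the far field AT THE STATE ITSELF, in tree vocabulary —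
`RhW08.AntiEscapeSplit7.newtonK f j v` (the field the OTHER zeros exert at `v`, `= f⁽ʲ⁺²⁾(v)/(2f⁽ʲ⁺¹⁾(v))`) with the conjugate's term
`1/(v − v̄) = −i/(2·Im v)` removed.  (`Im (tiltAt f j v)` is lens-1's `J_ext(v)`.)  This is the instrument-facing observable of the lens:
ONE complex number per (level, lowest state). -/
noncomputable def tiltAt (f : ℂ → ℂ) (j : ℕ) (v : ℂ) : ℂ :=
  RhW08.AntiEscapeSplit7.newtonK f j v + Complex.I / (2 * (v.im : ℂ))

/-- (B1, PROVABLE NOW — one `deriv_div`) **the discrete Riccati step**: `φ_{j+1}(w) = φ_j(w) + φ_j′(w)/φ_j(w)` wherever `f⁽ʲ⁾ w ≠ 0 ≠ f⁽ʲ⁺¹⁾ w`.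
This single identity carries the whole zero bookkeeping of one differentiation (new poles at the critical points with residue `+1`, old zeros lose
one unit of residue) and is the generator of the lens. -/
def RiccatiStep : Prop :=
  ∀ (f : ℂ → ℂ) (j : ℕ) (w : ℂ), Differentiable ℂ f → iteratedDeriv j f w ≠ 0 → iteratedDeriv (j + 1) f w ≠ 0 →
    levelField f (j + 1) w = levelField f j w + deriv (levelField f j) w / levelField f j w

/-- (B2, PROVABLE NOW — Taylor coefficients of `pairQ·h` at its zero) **the far field one level up is point data two levels up**:
at a simple non-real zero `u` of `F := f⁽ʲ⁺¹⁾` with cofactor `h` (`F = pairQ (Re u) (Im u)·h` near `u`),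
`h′(u)/h(u) = F″(u)/(2F′(u)) − 1/(u − ū)`, i.e. `K_{j+1}(u) = φ_{j+2}(u)/2 + i/(2·Im u)`. Heredity of the far field thus becomes a statement
about THREE consecutive levels at ONE point. -/
def ChildFarFieldFormula : Prop :=
  ∀ (f h : ℂ → ℂ) (j : ℕ) (u : ℂ) (ρ : ℝ), Differentiable ℂ f → 0 < ρ → u.im ≠ 0 →
    DifferentiableOn ℂ h (Metric.ball u ρ) → (∀ z ∈ Metric.ball u ρ, iteratedDeriv (j + 1) f z = pairQ u.re u.im z * h z) → h u ≠ 0 →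
    deriv h u / h u = iteratedDeriv (j + 3) f u / (2 * iteratedDeriv (j + 2) f u) - 1 / (u - conj u)

/-- (B3, PROVABLE NOW — real algebra) **far pairs push down**: a conjugate pair `u, ū` laterally at least `|Im u|` away from an upper point `w`
contributes a field with NEGATIVE imaginary part at `w` (equivalent to `Im u² − Im w² < Re(w−u)²`). With `2·Hs ≤ R` (in `EngineHyps5`) every
foreign zero at a `FarLevelQ` level that is laterally `≥ R/2 + hmax` from the state qualifies; by `RhW08.FarStep.drop_formula` a non-positive `Im K(w)`
only INCREASES the energy drop, so F1 reduces to a bound on `‖K‖` (the modulus law below). -/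
def FarPairsPushDown : Prop :=
  ∀ (w u : ℂ), 0 < w.im → |u.im| ≤ |w.re - u.re| → (1 / (w - u) + 1 / (w - conj u)).im < 0

/-- (B6 = the far step's hypothesis, i.e. F1 «through» `sharp_step_energy_eta_weak`; listed ONLY to make the reduction explicit — by itself a
COSTUME of F1, new content 0) **far-field modulus law** with allowance `λ`: at a charged far level the far field at an upper zero `w` of `f⁽ʲ⁺¹⁾`
nested in the lowest state's Jensen disc has `‖K_j(w)‖ ≤ λ·η/s`. F1(4/5) needs `λ = √5/2 ≈ 1.118`. -/
def FarFieldModulusLaw (lam : ℝ) : Prop :=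
  ∀ (η : ℝ) (f : ℂ → ℂ) (x₀ s hmax R Hs : ℝ) (B : ℕ), EngineHyps5 2 η f x₀ s hmax R Hs B →
    ∀ (j : ℕ) (v w : ℂ), FarLevelQ η f x₀ s hmax R Hs B j → Charged (PTrkSQ PBot) StTrkDQ ReadyR2 η f x₀ s hmax R Hs B j →
      IsLowest StTrkDQ η f x₀ s hmax R Hs B j v → iteratedDeriv (j + 1) f v ≠ 0 →
        (∀ z : ℂ, iteratedDeriv j f z = 0 → |z.re - v.re| < R / 2 → z = v ∨ z = conj v) → iteratedDeriv (j + 1) f w = 0 → 0 < w.im → ‖w - v‖ ≤ |v.im| →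
      ‖farFieldAt f j v w‖ ≤ lam * η / s

/-- (B4, UNDECIDED — the lens's bet; INSTRUMENTABLE) **tilt invariance along a far chain**: if levels `j₀ … j` are all charged far levels of
the frame, the far field at the nested upper critical point of the lowest state changes by at most the factor `1 + θ` between `j₀` and `j`.
Mechanism: B1+B2 make `K_{j+1}(w_{j+1}) − K_j(w_j)` an explicitly SECOND-ORDER quantity (march × gradient cancels the Riccati increment);
keep/kill number = the maximal relative drift on adversarial exactly-evolvable frames (measured +1.0e-3 … +2.3 % per chain; kill at +11.8 %). -/
def TiltInvarianceLaw (θ : ℝ) : Prop :=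
  ∀ (η : ℝ) (f : ℂ → ℂ) (x₀ s hmax R Hs : ℝ) (B : ℕ), EngineHyps5 2 η f x₀ s hmax R Hs B →
    ∀ (j₀ j : ℕ), j₀ ≤ j →
      (∀ i : ℕ, j₀ ≤ i → i ≤ j → FarLevelQ η f x₀ s hmax R Hs B i ∧ Charged (PTrkSQ PBot) StTrkDQ ReadyR2 η f x₀ s hmax R Hs B i) →
      ∀ (v₀ w₀ v w : ℂ), IsLowest StTrkDQ η f x₀ s hmax R Hs B j₀ v₀ → iteratedDeriv (j₀ + 1) f v₀ ≠ 0 →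
        (∀ z : ℂ, iteratedDeriv j₀ f z = 0 → |z.re - v₀.re| < R / 2 → z = v₀ ∨ z = conj v₀) → iteratedDeriv (j₀ + 1) f w₀ = 0 → 0 < w₀.im → ‖w₀ - v₀‖ ≤ |v₀.im| →
        IsLowest StTrkDQ η f x₀ s hmax R Hs B j v → iteratedDeriv (j + 1) f v ≠ 0 →
        (∀ z : ℂ, iteratedDeriv j f z = 0 → |z.re - v.re| < R / 2 → z = v ∨ z = conj v) → iteratedDeriv (j + 1) f w = 0 → 0 < w.im → ‖w - v‖ ≤ |v.im| →
        ‖farFieldAt f j v w‖ ≤ (1 + θ) * ‖farFieldAt f j₀ v₀ w₀‖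

/-- (B4-S, UNDECIDED; the SAME bet read at the states — the instrument's column) **tilt invariance, state form**: along a chain of charged far
levels the tilt at the lowest state changes by at most the factor `1 + θ`.  Keep/kill number = `max_j ‖tiltAt f j v_j‖ / ‖tiltAt f j₀ v_{j₀}‖ − 1`
over every maximal charged-far chain of every censused + adversarial frame (kill the line at `> 0.118`; kill F1 itself at a level with
`‖tiltAt‖·s/η > 1.118` up to the child/state offset). -/
def TiltInvarianceLawS (θ : ℝ) : Prop :=
  ∀ (η : ℝ) (f : ℂ → ℂ) (x₀ s hmax R Hs : ℝ) (B : ℕ), EngineHyps5 2 η f x₀ s hmax R Hs B →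
    ∀ (j₀ j : ℕ), j₀ ≤ j →
      (∀ i : ℕ, j₀ ≤ i → i ≤ j → FarLevelQ η f x₀ s hmax R Hs B i ∧ Charged (PTrkSQ PBot) StTrkDQ ReadyR2 η f x₀ s hmax R Hs B i) →
      ∀ (v₀ v : ℂ), IsLowest StTrkDQ η f x₀ s hmax R Hs B j₀ v₀ → iteratedDeriv (j₀ + 1) f v₀ ≠ 0 →
        (∀ z : ℂ, iteratedDeriv j₀ f z = 0 → |z.re - v₀.re| < R / 2 → z = v₀ ∨ z = conj v₀) → IsLowest StTrkDQ η f x₀ s hmax R Hs B j v → iteratedDeriv (j + 1) f v ≠ 0 →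
        (∀ z : ℂ, iteratedDeriv j f z = 0 → |z.re - v.re| < R / 2 → z = v ∨ z = conj v) →
        ‖tiltAt f j v‖ ≤ (1 + θ) * ‖tiltAt f j₀ v₀‖

/-- (B5, UNDECIDED — the residual of the residual; INSTRUMENTABLE) **far-chain entry law**: at the FIRST level of a far chain (level `0`, or a far
charged level whose predecessor is not a charged far level) the far field at the nested upper critical point is `≤ (1 + θ')·η/s`.  At `j = 0`
this is `RemainderBox` up to the lateral offset of `w` (the far-step kit's level-0 clause); for `j ≥ 1` nothing in `EngineHyps5` speaks to it —
test: screened-tilt frames `(z²+b²) e^{cz} ∏ (z − a_k)^{M_k}` with `c` up to `2.8·η/s` legal at level 0. -/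
def FarEntryLaw (θ' : ℝ) : Prop :=
  ∀ (η : ℝ) (f : ℂ → ℂ) (x₀ s hmax R Hs : ℝ) (B : ℕ), EngineHyps5 2 η f x₀ s hmax R Hs B →
    ∀ (j : ℕ) (v w : ℂ), FarLevelQ η f x₀ s hmax R Hs B j → Charged (PTrkSQ PBot) StTrkDQ ReadyR2 η f x₀ s hmax R Hs B j →
      (j = 0 ∨ ¬ (FarLevelQ η f x₀ s hmax R Hs B (j - 1) ∧ Charged (PTrkSQ PBot) StTrkDQ ReadyR2 η f x₀ s hmax R Hs B (j - 1))) →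
      IsLowest StTrkDQ η f x₀ s hmax R Hs B j v → iteratedDeriv (j + 1) f v ≠ 0 →
        (∀ z : ℂ, iteratedDeriv j f z = 0 → |z.re - v.re| < R / 2 → z = v ∨ z = conj v) → iteratedDeriv (j + 1) f w = 0 → 0 < w.im → ‖w - v‖ ≤ |v.im| →
      ‖farFieldAt f j v w‖ ≤ (1 + θ') * η / s

/-- (GLUE-1, PROVABLE NOW — induction on the chain start) entry + invariance ⇒ the modulus law with `λ = (1+θ)(1+θ')`. -/
def ModulusOfEntryAndInvariance : Prop :=
  ∀ θ θ' : ℝ, 0 ≤ θ → 0 ≤ θ' → TiltInvarianceLaw θ → FarEntryLaw θ' → FarFieldModulusLaw ((1 + θ) * (1 + θ'))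

/-- (GLUE-2, ATTACKABLE — the tree's sharp far step `RhW08.FarStep.sharp_step_energy_eta_weak` + nestedness of the successor
(`Literature.…jensen_circle_iteratedDeriv_pos`) + the books' identification of `lowH` at `j`, `j+1` with the lowest state and its successor on a charged
far level (lineage lemmas of `RhW07.C14.Lineage`); the `11.8 %` allowance is exactly `λ² ≤ 5/4`) modulus law ⇒ F1. -/
def F1OfModulusLaw : Prop :=
  ∀ lam : ℝ, 0 < lam → lam ^ 2 ≤ 5 / 4 → FarFieldModulusLaw lam → FarEnergyLawCQ (4 / 5)

/-- NODE ASSEMBLY (lens-2, RATE/F1): the two undecided laws with `(1+θ)(1+θ') ≤ √5/2` and the two glues give F1. -/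
def NodeAssembly : Prop :=
  ∀ θ θ' : ℝ, 0 ≤ θ → 0 ≤ θ' → ((1 + θ) * (1 + θ')) ^ 2 ≤ 5 / 4 →
    ModulusOfEntryAndInvariance → F1OfModulusLaw → TiltInvarianceLaw θ → FarEntryLaw θ' → FarEnergyLawCQ (4 / 5)

/-- The assembly is pure logic (kernel-checked here so the node's arrow is not hand-waved). -/
theorem nodeAssembly_holds : NodeAssembly := by
  intro θ θ' hθ hθ' hsq hG1 hG2 hT hE
  have hlam : 0 < (1 + θ) * (1 + θ') := by positivity
  exact hG2 _ hlam hsq (hG1 θ θ' hθ hθ' hT hE)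

/-- (B3 is elementary; proved here as the lens's first kernel-checked lemma.) -/
theorem farPairsPushDown_holds : FarPairsPushDown := by
  intro w u hw hlat
  have key : ∀ (X y H : ℝ), 0 < y → |H| ≤ |X| →
      -(y - H) / (X ^ 2 + (y - H) ^ 2) + (-(y + H) / (X ^ 2 + (y + H) ^ 2)) < 0 := by
    intro X y H hy hH
    have hX2 : H ^ 2 ≤ X ^ 2 := by
      have := mul_self_le_mul_self (abs_nonneg H) hH
      rw [abs_mul_abs_self, abs_mul_abs_self] at this
      nlinarith [this]
    have hD1 : 0 < X ^ 2 + (y - H) ^ 2 := by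
      rcases eq_or_ne (y - H) 0 with h0 | h0
      · have : H ^ 2 = y ^ 2 := by nlinarith [h0]
        nlinarith [sq_nonneg X, this, hy]
      · positivity
    have hD2 : 0 < X ^ 2 + (y + H) ^ 2 := by
      rcases eq_or_ne (y + H) 0 with h0 | h0
      · have : H ^ 2 = y ^ 2 := by nlinarith [h0]
        nlinarith [sq_nonneg X, this, hy]
      · positivity
    rw [div_add_div _ _ hD1.ne' hD2.ne', div_neg_iff]
    right
    refine ⟨?_, mul_pos hD1 hD2⟩
    have hfac : -(y - H) * (X ^ 2 + (y + H) ^ 2) + (X ^ 2 + (y - H) ^ 2) * -(y + H)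
        = -(2 * y * (X ^ 2 + y ^ 2 - H ^ 2)) := by ring
    rw [hfac, neg_lt_zero]
    have : 0 < X ^ 2 + y ^ 2 - H ^ 2 := by nlinarith [hX2, hy]
    positivity
  have h1 : (1 / (w - u) + 1 / (w - conj u)).im
      = -(w.im - u.im) / ((w.re - u.re) ^ 2 + (w.im - u.im) ^ 2)
        + (-(w.im + u.im) / ((w.re - u.re) ^ 2 + (w.im + u.im) ^ 2)) := by
    simp only [Complex.add_im, one_div, Complex.inv_im, Complex.sub_im, Complex.sub_re, Complex.conj_re, Complex.conj_im,
      Complex.normSq_apply]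
    ring
  rw [h1]
  exact key (w.re - u.re) w.im u.im hw (by simpa [abs_sub_comm] using hlat)

end RhW08.BurgersRate
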